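import Summits.CriticalPhenomena.Ising3D.Control2DL19BoxXData146
import HarnessLib

/-!
(controls-1 g24: SPLIT companion of `Control2DL19BoxXData146` — spin-0 Bernstein leaves 5–9 on the literal `phatboxXs0` of that file; nothing else.)
# Kernel replay of the RB-2 certificate `j141725_functional_deriv2d_L19_E048_sig1o8_box0.985-0.99.json` (Λ = 19, E₀ = 48): Δ_ε ∉ [197/200, 99/100] at Δ_σ = 1/8 under A2D′: cell data, SPIN file: assembly + Bernstein leaves of spins 0
(cell `pub-ising3x`, seat controls-1 gen 20; KERNEL PATH for the 2D γ-certificates, Λ = 19 — CONTROL-ONLY)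

HONEST FRAMING: lottery ticket; floor = tightest certified 3D Ising CFT bounds; no exact-solution
claim without a proof. CONTROL-ONLY (`d = 2`, `Δ_σ = 1/8`; axiom set A2D′).

FLAT layout (controls-1 g18, `Control2DCellGroups`): each spin's cell polynomial `cellPolyZ wtboxX slL19 19 ℓ Nd` is the
coefficientwise sum of INDEPENDENT index-group sums `cellPolyAcc wtboxX G 19 ℓ Nd []`, each assembled in the kernel from the
table-independent one-sided literals `uZ Nd c k` (library files `Control2DUZ*`) into a literal `grp…` (`simp only` +
`decide +kernel`) in a GROUP file (no imports between data files of one spin); the SPIN file adds the group literals in the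
kernel (`cellPolyZ_of_groups`, one `decide`) into the literal `phat…` and decides every Bernstein leaf `bernAuto phat q a L = true`
(coefficients computed in the kernel, `Control2DPolyCertAuto`). Data + kernel decisions only; the cell theorems proper are
assembled in `Control2DL19BoxXCells`. All integers come from the seat's exact mirror (HOME/code/controls/kp5: kmirror.py / gen_flat.py,
cross-checked against the independent rational twin twin.py) and are only CHECKED here. No facts, standard axioms only.
-/

namespace Summit.CriticalPhenomena.Ising3D.Control2D

open Literature.MathematicalPhysics.QuantumFieldTheory.ConformalBootstrap3D

set_option maxHeartbeats 0 in
set_option maxRecDepth 200000 in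
/-- **Kernel check of spin 0, leaf 5** (`y ∈ [133/64, 156/64]`, range C0; Bernstein coefficients of the coefficients truncated by `10^563`, computed in the kernel). [folklore] -/
theorem cellChk_boxX_s0l5 : bernAuto (ptrunc phatboxXs0 563) 64 133 23 = true := by
  decide +kernel

set_option maxHeartbeats 0 in
set_option maxRecDepth 200000 in
/-- **Kernel check of spin 0, leaf 6** (`y ∈ [39/16, 62/16]`, range C0; Bernstein coefficients of the coefficients truncated by `10^553`, computed in the kernel). [folklore] -/
theorem cellChk_boxX_s0l6 : bernAuto (ptrunc phatboxXs0 553) 16 39 23 = true := by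
  decide +kernel

set_option maxHeartbeats 0 in
set_option maxRecDepth 200000 in
/-- **Kernel check of spin 0, leaf 7** (`y ∈ [248/64, 271/64]`, range C0; Bernstein coefficients of the coefficients truncated by `10^553`, computed in the kernel). [folklore] -/
theorem cellChk_boxX_s0l7 : bernAuto (ptrunc phatboxXs0 553) 64 248 23 = true := by
  decide +kernel

set_option maxHeartbeats 0 in
set_option maxRecDepth 200000 in
/-- **Kernel check of spin 0, leaf 8** (`y ∈ [542/128, 565/128]`, range C0; Bernstein coefficients of the coefficients truncated by `10^553`, computed in the kernel). [folklore] -/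
theorem cellChk_boxX_s0l8 : bernAuto (ptrunc phatboxXs0 553) 128 542 23 = true := by
  decide +kernel

set_option maxHeartbeats 0 in
set_option maxRecDepth 200000 in
/-- **Kernel check of spin 0, leaf 9** (`y ∈ [1130/256, 1153/256]`, range C0; Bernstein coefficients of the coefficients truncated by `10^553`, computed in the kernel). [folklore] -/
theorem cellChk_boxX_s0l9 : bernAuto (ptrunc phatboxXs0 553) 256 1130 23 = true := by
  decide +kernel

end Summit.CriticalPhenomena.Ising3D.Control2D
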